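import Summits.HodgeConjecture.CorCM.PairFlipCMFieldOrbitCriterion
import Summits.HodgeConjecture.CorCM.StabiliserOrbitReflexSlot
import Summits.HodgeConjecture.CorCM.ReflexOcticHodgeOfTraceField
import HarnessLib

/-!
# A generic CM field of ANY degree against its REFLEX field: `Hg(A₀ × A₁) = Hg(A₀) × Hg(A₁)` iff the incidence numbers
# of the partner type at the embeddings of the base are not constant and unequal on / off the base type

COR-CM (cell `pub-hodgecm2`, binder seat `b16` gen 53, count-neutral claim ORBIT-CRITERION, file F4b — CM fields and
abelian varieties; theorems only, no definition, no named fact, no `sorry`).  NEW as stated, hence under `Summits/`.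
HONEST FRAMING: unconditional statements about pairs of CM types and products of CM abelian varieties; `HC_CM` is neither
used nor asserted.

SETTING.  `K_{i₀}` a CM field of degree `2n` with PAIR FLIPS (generic), type `Φ₀ = Φ_{i₀}`; `K_{i₁}` a CM field with a
REFLEX EMBEDDING `ψ₀ : K_{i₁} → ℂ` for `Φ₀`: the fixer of `ψ₀` in `Aut(ℂ)` is the stabiliser of `Φ₀` — `ψ₀(K_{i₁})` is the
reflex field of `(K_{i₀}, Φ₀)` (Shimura §8.3 Prop. 28; `[K_{i₁} : ℚ] = #(Aut(ℂ)·Φ₀) = 2ⁿ` by Dodson's Reflex Degree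
Theorem, all `2ⁿ` types being conjugate under the flips).  The type attached to `y = σψ₀` is `σΦ₀`, i.e.
`x ∈ T(y) ⟺ ∃ σ, σψ₀ = y ∧ σ⁻¹x ∈ Φ₀`; the INCIDENCE NUMBER of a type `Φ₁ = Φ_{i₁}` of `K_{i₁}` at `x : K_{i₀} → ℂ` is
`N(x) = #{y ∈ Φ₁ : ∃ σ, σψ₀ = y ∧ σ⁻¹x ∈ Φ₀}` — the number of members of `Φ₁` whose attached type contains `x`
(`= #(Φ₁ ∩ g·Φ₀*)` at `x = g x₀`, `Φ₀*` the reflex type).  F4a (`StabiliserOrbitReflexSlot`) showed that `Stab(x₀)` is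
transitive on `Φ₀*` and that no embedding lies off `Φ₀* ∪ Φ̄₀*`, so F2/F3's one-orbit criterion applies verbatim:

* §1 **`isNondegenerateFamily_iff_of_pairFlip_of_reflexEmbedding`**, **`cmFamilyRank_add_card_eq_iff_of_pairFlip_of_reflexEmbedding`**
  — generic `K_{i₀}` of ANY degree against a reflex-embedded `K_{i₁}`, ANY types: the pair `(Φ₀, Φ₁)` is nondegenerate
  (resp. `Hg(A₀ × A₁) = Hg(A₀) × Hg(A₁)`) IFF `Φ₁` is nondegenerate and (resp. iff) `N` is NOT `a` on `Φ₀`, `b` off `Φ₀`,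
  `a ≠ b`; `not_isNondegenerateFamily_of_reflexIncidence`: constant unequal incidence ⟹ degenerate (no flip hypothesis);
  `isNondegenerateFamily_iff_of_pairFlip_of_range_eq_traceField`: the same from `ψ₀(K_{i₁}) = traceField Φ₀ = ℚ(tr_{Φ₀} K_{i₀})`
  (the complex reflex field; gen 45's bridge `smul_eq_iff_forall_smul_mem_iff_of_range_eq_traceField`, Shimura Prop. 28).
  `n = 3`: `N ≡ (3,1)`/`(1,3)` are exactly gen 45's two Hamming balls (`PairFlipSexticTimesReflexOcticHodge`, now a
  corollary); `n = 4` (generic CM fourfold against the CM 8-folds of its degree-16 reflex field): exactly 8 of the 256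
  types of the reflex slot are exceptional against `Φ₀ = (++++)`, with `N ≡ (5,3)`/`(3,5)`, e.g.
  `{++++, −+++, +−++, ++−+, −−−+, ++−−, +−+−, −++−}` (brute force over sign coordinates; not a kernel statement).
* §2 **`hodgeConjectureFor_prod_of_pairFlip_of_reflexEmbedding`** (HC with `B• = D•` on every `A₀^a × A₁^b` when `Φ₁` is
  nondegenerate with non-constant-unequal incidence — unconditionally), **`forall_prod_hodgeClassSpan_eq_iff_of_pairFlip_of_reflexEmbedding`**
  (simple non-isogenous: `B• = D•` on all products IFF the criterion), **`exists_exceptional_prod_of_reflexIncidence`**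
  (constant unequal incidence ⟹ an exceptional Hodge class on some `A₀^a × A₁^b`).

## References

* [Shimura1998] G. Shimura, *Abelian Varieties with Complex Multiplication and Modular Functions*, §8.3 Prop. 28, §8.4.
* [Dodson1984] B. Dodson, *The structure of Galois groups of CM-fields*, Trans. AMS 283 (1984), §1 (Reflex Degree
  Theorem and Remark), §3.3.2, §5.1.2, Prop. 5.2.2.
* [Gordon1999HodgeAVSurvey] B. B. Gordon, *A survey of the Hodge conjecture for abelian varieties*, §3 Theorem, 7.5–7.7,
  9.4.3, 10.10.
-/

noncomputable section

open scoped BigOperators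

namespace Summit.HodgeConjecture.CorCM

/-! ### §1 CM fields: a pair-flip field of any degree against its reflex field -/

open CategoryTheory CategoryTheory.Limits NumberField Module
open Literature.NumberTheory.ComplexMultiplication
open Literature.AlgebraicGeometry.Motives (AbelianVariety CMType)
open Literature.AlgebraicGeometry.HodgeTheory
open Literature.AlgebraicGeometry.ComplexMultiplication (IsCMTypeRealisation)
open Literature.AlgebraicGeometry.VanGeemen1994 (hodgeClassSpan)
open Literature.AlgebraicGeometry.Pohlmann1968
open Literature.Barriers.HodgeConjecture (divisorClassesSpan)
open scoped Classical

variable {I : Type} {K : I → Type} [∀ i, Field (K i)] [∀ i, NumberField (K i)] [∀ i, IsCMField (K i)] [Fintype I]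
  [DecidableEq I] {Φ : ∀ i, CMType (K i)} {i₀ i₁ : I}

omit [∀ i, IsCMField (K i)] [DecidableEq I] in
/-- `|⊔_i Hom(K_i, ℂ)| = Σ_i [K_i : ℚ]`. [folklore] -/
private theorem card_sigma_ringHom_eq_sum₅₃' : Fintype.card ((i : I) × (K i →+* ℂ)) = ∑ i, finrank ℚ (K i) := by
  rw [Fintype.card_sigma]
  exact Finset.sum_congr rfl fun i _ => Embeddings.card (K i) ℂ

section Types

omit [Fintype I] [DecidableEq I] [∀ i, NumberField (K i)] [∀ i, IsCMField (K i)] in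
/-- **The reflex slot of a reflex embedding, with incidence read through `ψ₀`.**  For `ψ₀` with `Fix(ψ₀) = Stab(Φ₀)`: a
type map `T` (equivariant, injective, `T ψ₀ = Φ₀`) with `x ∈ T y ⟺ ∃ σ, σψ₀ = y ∧ σ⁻¹x ∈ Φ₀`.
[cite: Shimura1998, §8.3 Prop. 28] [cite: Dodson1984, §1 (Remark after the Reflex Degree Theorem)] -/
theorem exists_typeMap_of_reflexEmbedding [NumberField (K i₁)] (Φ₀ : CMType (K i₀)) {ψ₀ : K i₁ →+* ℂ}
    (hψ₀ : ∀ σ : ℂ ≃+* ℂ, σ • ψ₀ = ψ₀ ↔ ∀ x : K i₀ →+* ℂ, σ • x ∈ Φ₀.1 ↔ x ∈ Φ₀.1) :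
    ∃ T : (K i₁ →+* ℂ) → Set (K i₀ →+* ℂ),
      (∀ (g : ℂ ≃+* ℂ) (y : K i₁ →+* ℂ) (x : K i₀ →+* ℂ), x ∈ T (g • y) ↔ g⁻¹ • x ∈ T y) ∧
      Function.Injective T ∧ T ψ₀ = Φ₀.1 ∧ (∀ y : K i₁ →+* ℂ, ∃ g : ℂ ≃+* ℂ, g • ψ₀ = y) ∧
      ∀ (x : K i₀ →+* ℂ) (y : K i₁ →+* ℂ), x ∈ T y ↔ ∃ σ : ℂ ≃+* ℂ, σ • ψ₀ = y ∧ σ⁻¹ • x ∈ Φ₀.1 := by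
  haveI := isPretransitive_ringEquiv_complex (K := K i₁)
  have hY : ∀ y : K i₁ →+* ℂ, ∃ g : ℂ ≃+* ℂ, g • ψ₀ = y := fun y => MulAction.exists_smul_eq (ℂ ≃+* ℂ) ψ₀ y
  obtain ⟨T, hT, hTi, hT₀⟩ := ReflexSlot.exists_typeMap (G := ℂ ≃+* ℂ) (Φ₀ := Φ₀.1) (y₀ := ψ₀) hψ₀ hY
  exact ⟨T, hT, hTi, hT₀, hY, ReflexSlot.mem_typeMap_iff_exists_smul_base hT hT₀ hY⟩

omit [DecidableEq I] in
/-- **Constant unequal incidence numbers make the pair degenerate** (any CM field `K_{i₀}`, `ψ₀` a reflex embedding for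
`Φ₀`, NO flip hypothesis): if `#{y ∈ Φ₁ : ∃ σ, σψ₀ = y ∧ σ⁻¹x ∈ Φ₀}` is `a` on `Φ₀` and `b ≠ a` off `Φ₀`, then `(Φ₀, Φ₁)`
is degenerate. [cite: Gordon1999HodgeAVSurvey, 7.5–7.7 and 9.4.3] [cite: Dodson1984, §3.3.2 and Prop. 5.2.2] -/
theorem not_isNondegenerateFamily_of_reflexIncidence (h01 : i₀ ≠ i₁) {ψ₀ : K i₁ →+* ℂ}
    (hψ₀ : ∀ σ : ℂ ≃+* ℂ, σ • ψ₀ = ψ₀ ↔ ∀ x : K i₀ →+* ℂ, σ • x ∈ (Φ i₀).1 ↔ x ∈ (Φ i₀).1) {a b : ℕ} (hab : a ≠ b)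
    (hN : ∀ x : K i₀ →+* ℂ, (Finset.univ.filter fun y : K i₁ →+* ℂ =>
      y ∈ (Φ i₁).1 ∧ ∃ σ : ℂ ≃+* ℂ, σ • ψ₀ = y ∧ σ⁻¹ • x ∈ (Φ i₀).1).card = if x ∈ (Φ i₀).1 then a else b) :
    ¬ CMAlgebra.IsNondegenerateFamily Φ := by
  haveI : Nonempty I := ⟨i₀⟩
  obtain ⟨T, hT, -, -, -, hmem⟩ := exists_typeMap_of_reflexEmbedding (Φ i₀) hψ₀
  refine not_isNondegenerateFamily_of_cmFamilyRank_add_card_lt Φ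
    (ReflexSlot.typeRank_sigmaType_add_card_lt_of_incidence (G := ℂ ≃+* ℂ) (Φ := fun i => (Φ i).1)
      (fun i => isCMTypeWith_conj (Φ i)) h01 hT hab fun x => ?_)
  simp only [hmem]
  exact hN x

/-- **GENERIC FIELD × REFLEX FIELD, ANY DEGREE (nondegeneracy form).**  `I = {i₀, i₁}`, `K_{i₀}` with pair flips, `ψ₀` a
reflex embedding of `K_{i₁}` for `Φ₀`: the pair `(Φ₀, Φ₁)` is nondegenerate IFF `Φ₁` is nondegenerate AND the incidence
numbers `N(x) = #{y ∈ Φ₁ : ∃ σ, σψ₀ = y ∧ σ⁻¹x ∈ Φ₀}` are NOT `a` on `Φ₀`, `b` off `Φ₀` with `a ≠ b`.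
[cite: Gordon1999HodgeAVSurvey, 7.5–7.7 and 9.4.3] [cite: Dodson1984, §1.1, §3.3.2 and §5.1.2] [cite: Shimura1998, §8.3 Prop. 28] -/
theorem isNondegenerateFamily_iff_of_pairFlip_of_reflexEmbedding (hI : ∀ i, i = i₀ ∨ i = i₁) (h01 : i₀ ≠ i₁)
    (hflip₀ : ∀ x : K i₀ →+* ℂ, ∃ σ : ℂ ≃+* ℂ, σ • x = (starRingAut : ℂ ≃+* ℂ) • x ∧
      ∀ x' : K i₀ →+* ℂ, x' ≠ x → x' ≠ (starRingAut : ℂ ≃+* ℂ) • x → σ • x' = x')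
    {ψ₀ : K i₁ →+* ℂ}
    (hψ₀ : ∀ σ : ℂ ≃+* ℂ, σ • ψ₀ = ψ₀ ↔ ∀ x : K i₀ →+* ℂ, σ • x ∈ (Φ i₀).1 ↔ x ∈ (Φ i₀).1) :
    CMAlgebra.IsNondegenerateFamily Φ ↔ IsNondegenerate (Φ i₁) ∧
      ¬ ∃ a b : ℕ, a ≠ b ∧ ∀ x : K i₀ →+* ℂ,
        (Finset.univ.filter fun y : K i₁ →+* ℂ =>
          y ∈ (Φ i₁).1 ∧ ∃ σ : ℂ ≃+* ℂ, σ • ψ₀ = y ∧ σ⁻¹ • x ∈ (Φ i₀).1).card =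
          if x ∈ (Φ i₀).1 then a else b := by
  haveI := isPretransitive_ringEquiv_complex (K := K i₀)
  haveI : Nonempty I := ⟨i₀⟩
  obtain ⟨T, hT, hTi, hT₀, hY, hmem⟩ := exists_typeMap_of_reflexEmbedding (Φ i₀) hψ₀
  have key := ReflexSlot.typeRank_sigmaType_eq_iff_of_pairFlip_of_typeMap (G := ℂ ≃+* ℂ) (Φ := fun i => (Φ i).1)
    (fun i => isCMTypeWith_conj (Φ i)) hI h01 hflip₀ hT hTi hT₀ hY
  rw [CMAlgebra.isNondegenerateFamily_iff, ← card_sigma_ringHom_eq_sum₅₃' (K := K), isNondegenerate_iff, cmTypeRank,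
    ← Embeddings.card (K i₁) ℂ]
  refine key.trans ?_
  simp only [hmem]

/-- **GENERIC FIELD × REFLEX FIELD, ANY DEGREE (rank form)**: `rank(Φ₀, Φ₁) + 2 = rank Φ₀ + rank Φ₁ + 1`
(`Hg(A₀ × A₁) = Hg(A₀) × Hg(A₁)`) IFF the incidence numbers are not constant-unequal on / off `Φ₀`.
[cite: Gordon1999HodgeAVSurvey, §3 Theorem (1), 7.5–7.7 and 9.4.3] [cite: Dodson1984, §5.1.2] -/
theorem cmFamilyRank_add_card_eq_iff_of_pairFlip_of_reflexEmbedding (hI : ∀ i, i = i₀ ∨ i = i₁) (h01 : i₀ ≠ i₁)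
    (hflip₀ : ∀ x : K i₀ →+* ℂ, ∃ σ : ℂ ≃+* ℂ, σ • x = (starRingAut : ℂ ≃+* ℂ) • x ∧
      ∀ x' : K i₀ →+* ℂ, x' ≠ x → x' ≠ (starRingAut : ℂ ≃+* ℂ) • x → σ • x' = x')
    {ψ₀ : K i₁ →+* ℂ}
    (hψ₀ : ∀ σ : ℂ ≃+* ℂ, σ • ψ₀ = ψ₀ ↔ ∀ x : K i₀ →+* ℂ, σ • x ∈ (Φ i₀).1 ↔ x ∈ (Φ i₀).1) :
    CMAlgebra.cmFamilyRank Φ + Fintype.card I = (∑ i, cmTypeRank (Φ i)) + 1 ↔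
      ¬ ∃ a b : ℕ, a ≠ b ∧ ∀ x : K i₀ →+* ℂ,
        (Finset.univ.filter fun y : K i₁ →+* ℂ =>
          y ∈ (Φ i₁).1 ∧ ∃ σ : ℂ ≃+* ℂ, σ • ψ₀ = y ∧ σ⁻¹ • x ∈ (Φ i₀).1).card =
          if x ∈ (Φ i₀).1 then a else b := by
  haveI := isPretransitive_ringEquiv_complex (K := K i₀)
  haveI : Nonempty I := ⟨i₀⟩
  obtain ⟨T, hT, hTi, hT₀, hY, hmem⟩ := exists_typeMap_of_reflexEmbedding (Φ i₀) hψ₀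
  have key := ReflexSlot.typeRank_sigmaType_add_card_eq_iff_of_pairFlip_of_typeMap (G := ℂ ≃+* ℂ)
    (Φ := fun i => (Φ i).1) (fun i => isCMTypeWith_conj (Φ i)) hI h01 hflip₀ hT hTi hT₀ hY
  refine key.trans ?_
  simp only [hmem]

/-- **The same from the IMAGE of `ψ₀`**: if `ψ₀(K_{i₁}) = traceField Φ₀ = ℚ(tr_{Φ₀}(K_{i₀}))` (the complex reflex field) then
`Fix(ψ₀) = Stab(Φ₀)` (Shimura's Prop. 28, tree `smul_eq_iff_forall_smul_mem_iff_of_range_eq_traceField`) and the criterion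
applies. [cite: Shimura1998, §8.3 Prop. 28] [cite: Gordon1999HodgeAVSurvey, 7.5–7.7 and 9.4.3] -/
theorem isNondegenerateFamily_iff_of_pairFlip_of_range_eq_traceField (hI : ∀ i, i = i₀ ∨ i = i₁) (h01 : i₀ ≠ i₁)
    (hflip₀ : ∀ x : K i₀ →+* ℂ, ∃ σ : ℂ ≃+* ℂ, σ • x = (starRingAut : ℂ ≃+* ℂ) • x ∧
      ∀ x' : K i₀ →+* ℂ, x' ≠ x → x' ≠ (starRingAut : ℂ ≃+* ℂ) • x → σ • x' = x')
    {ψ₀ : K i₁ →+* ℂ} (hr : Set.range ψ₀ = (traceField (Φ i₀) : Set ℂ)) :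
    CMAlgebra.IsNondegenerateFamily Φ ↔ IsNondegenerate (Φ i₁) ∧
      ¬ ∃ a b : ℕ, a ≠ b ∧ ∀ x : K i₀ →+* ℂ,
        (Finset.univ.filter fun y : K i₁ →+* ℂ =>
          y ∈ (Φ i₁).1 ∧ ∃ σ : ℂ ≃+* ℂ, σ • ψ₀ = y ∧ σ⁻¹ • x ∈ (Φ i₀).1).card =
          if x ∈ (Φ i₀).1 then a else b :=
  isNondegenerateFamily_iff_of_pairFlip_of_reflexEmbedding hI h01 hflip₀
    (smul_eq_iff_forall_smul_mem_iff_of_range_eq_traceField (Φ i₀) ψ₀ hr)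

end Types

/-! ### §2 Abelian varieties -/

section Varieties

variable [Nonempty I] {A : I → AbelianVariety ℂ} {ι : ∀ i, 𝓞 (K i) →+* End (A i)}
  {θ : ∀ i, K i →+* Module.End ℂ (complexBetti (A i).X 1)}

/-- **The Hodge conjecture on every `A₀^a × A₁^b`** (every `⨁_{j<N} A_{π j}`), with `B• = D•` there, for a realisation
`A₀` of a type of a pair-flip CM field (any degree) and a realisation `A₁` of a NONDEGENERATE type of its reflex field
whose incidence numbers are not constant-unequal — UNCONDITIONALLY. [cite: Gordon1999HodgeAVSurvey, 7.5 and 10.10] -/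
theorem hodgeConjectureFor_prod_of_pairFlip_of_reflexEmbedding (hI : ∀ i, i = i₀ ∨ i = i₁) (h01 : i₀ ≠ i₁)
    (hflip₀ : ∀ x : K i₀ →+* ℂ, ∃ σ : ℂ ≃+* ℂ, σ • x = (starRingAut : ℂ ≃+* ℂ) • x ∧
      ∀ x' : K i₀ →+* ℂ, x' ≠ x → x' ≠ (starRingAut : ℂ ≃+* ℂ) • x → σ • x' = x')
    {ψ₀ : K i₁ →+* ℂ}
    (hψ₀ : ∀ σ : ℂ ≃+* ℂ, σ • ψ₀ = ψ₀ ↔ ∀ x : K i₀ →+* ℂ, σ • x ∈ (Φ i₀).1 ↔ x ∈ (Φ i₀).1)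
    (hnd : IsNondegenerate (Φ i₁))
    (hnot : ¬ ∃ a b : ℕ, a ≠ b ∧ ∀ x : K i₀ →+* ℂ,
      (Finset.univ.filter fun y : K i₁ →+* ℂ =>
        y ∈ (Φ i₁).1 ∧ ∃ σ : ℂ ≃+* ℂ, σ • ψ₀ = y ∧ σ⁻¹ • x ∈ (Φ i₀).1).card = if x ∈ (Φ i₀).1 then a else b)
    (hA : ∀ i, IsCMTypeRealisation (Φ i) (A i) (ι i) (θ i)) {N : ℕ} (π : Fin N → I) :
    HodgeConjectureFor (⨁ fun j : Fin N => A (π j)).dim (⨁ fun j : Fin N => A (π j)).X ∧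
      ∀ m : ℕ, hodgeClassSpan (⨁ fun j : Fin N => A (π j)).dim (⨁ fun j : Fin N => A (π j)).X m =
        divisorClassesSpan (⨁ fun j : Fin N => A (π j)).X (⨁ fun j : Fin N => A (π j)).dim m :=
  have h := (isNondegenerateFamily_iff_of_pairFlip_of_reflexEmbedding hI h01 hflip₀ hψ₀).2 ⟨hnd, hnot⟩
  ⟨h.hodgeConjectureFor_prod hA π, fun m => h.hodgeClassSpan_prod_eq_divisorClassesSpan hA π m⟩

/-- **SIMPLE, NON-ISOGENOUS realisations (pair-flip field × reflex field, any degree): `B• = D•` on ALL products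
`A₀^a × A₁^b` IFF `Φ₁` is nondegenerate and its incidence numbers are not constant-unequal**; otherwise some product
carries an exceptional Hodge class. [cite: Gordon1999HodgeAVSurvey, 7.5 and 7.6.1] -/
theorem forall_prod_hodgeClassSpan_eq_iff_of_pairFlip_of_reflexEmbedding (hI : ∀ i, i = i₀ ∨ i = i₁)
    (h01 : i₀ ≠ i₁)
    (hflip₀ : ∀ x : K i₀ →+* ℂ, ∃ σ : ℂ ≃+* ℂ, σ • x = (starRingAut : ℂ ≃+* ℂ) • x ∧
      ∀ x' : K i₀ →+* ℂ, x' ≠ x → x' ≠ (starRingAut : ℂ ≃+* ℂ) • x → σ • x' = x')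
    {ψ₀ : K i₁ →+* ℂ}
    (hψ₀ : ∀ σ : ℂ ≃+* ℂ, σ • ψ₀ = ψ₀ ↔ ∀ x : K i₀ →+* ℂ, σ • x ∈ (Φ i₀).1 ↔ x ∈ (Φ i₀).1)
    (hA : ∀ i, IsCMTypeRealisation (Φ i) (A i) (ι i) (θ i)) (hs : ∀ i, (A i).IsSimple)
    (hniso : ∀ i i', i ≠ i' → ¬ AbelianVariety.IsIsogenous (A i) (A i')) :
    (∀ (N : ℕ) (π : Fin N → I) (m : ℕ),
      hodgeClassSpan (⨁ fun j : Fin N => A (π j)).dim (⨁ fun j : Fin N => A (π j)).X m =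
        divisorClassesSpan (⨁ fun j : Fin N => A (π j)).X (⨁ fun j : Fin N => A (π j)).dim m) ↔
      IsNondegenerate (Φ i₁) ∧ ¬ ∃ a b : ℕ, a ≠ b ∧ ∀ x : K i₀ →+* ℂ,
        (Finset.univ.filter fun y : K i₁ →+* ℂ =>
          y ∈ (Φ i₁).1 ∧ ∃ σ : ℂ ≃+* ℂ, σ • ψ₀ = y ∧ σ⁻¹ • x ∈ (Φ i₀).1).card =
          if x ∈ (Φ i₀).1 then a else b := by
  rw [← CMAlgebra.isNondegenerateFamily_iff_forall_prod_hodgeClassSpan_eq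
    (CMAlgebra.isSeparatingFamily_of_isSimple_of_pairwise_not_isIsogenous hA hs hniso) hA]
  exact isNondegenerateFamily_iff_of_pairFlip_of_reflexEmbedding hI h01 hflip₀ hψ₀

omit [DecidableEq I] in
/-- **Constant unequal incidence numbers put an exceptional Hodge class** — a rational `(m,m)`-class outside `Dᵐ ⊗ ℂ` —
**on some `A₀^a × A₁^b`** (simple non-isogenous realisations; `ψ₀` a reflex embedding, no flip hypothesis).  For `n = 3`
these are the Hamming-ball fourfolds of gen 45; for `n = 4` e.g. the 8-set of the file docstring.
[cite: Gordon1999HodgeAVSurvey, 7.5, 7.6.1 and 9.4.3] [cite: Dodson1984, §3.3.2 and Prop. 5.2.2] -/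
theorem exists_exceptional_prod_of_reflexIncidence (h01 : i₀ ≠ i₁) {ψ₀ : K i₁ →+* ℂ}
    (hψ₀ : ∀ σ : ℂ ≃+* ℂ, σ • ψ₀ = ψ₀ ↔ ∀ x : K i₀ →+* ℂ, σ • x ∈ (Φ i₀).1 ↔ x ∈ (Φ i₀).1) {a b : ℕ} (hab : a ≠ b)
    (hN : ∀ x : K i₀ →+* ℂ, (Finset.univ.filter fun y : K i₁ →+* ℂ =>
      y ∈ (Φ i₁).1 ∧ ∃ σ : ℂ ≃+* ℂ, σ • ψ₀ = y ∧ σ⁻¹ • x ∈ (Φ i₀).1).card = if x ∈ (Φ i₀).1 then a else b)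
    (hA : ∀ i, IsCMTypeRealisation (Φ i) (A i) (ι i) (θ i)) (hs : ∀ i, (A i).IsSimple)
    (hniso : ∀ i i', i ≠ i' → ¬ AbelianVariety.IsIsogenous (A i) (A i')) :
    ∃ (N : ℕ) (π : Fin N → I) (m : ℕ) (c : complexBetti (⨁ fun j : Fin N => A (π j)).X (2 * m)),
      IsRationalClass c ∧
      IsOfHodgeType (⨁ fun j : Fin N => A (π j)).dim (⨁ fun j : Fin N => A (π j)).X (2 * m) m m c ∧
      c ∉ divisorClassesSpan (⨁ fun j : Fin N => A (π j)).X (⨁ fun j : Fin N => A (π j)).dim m :=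
  CMAlgebra.exists_exceptional_prod_of_not_isNondegenerateFamily
    (CMAlgebra.isSeparatingFamily_of_isSimple_of_pairwise_not_isIsogenous hA hs hniso)
    (not_isNondegenerateFamily_of_reflexIncidence h01 hψ₀ hab hN) hA

end Varieties

end Summit.HodgeConjecture.CorCM

end
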